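import Summits.BirchSwinnertonDyer.BirchSwinnertonDyer.Theorems.Rank2Observatory2DescClSplitImageSoundTwo
import Summits.BirchSwinnertonDyer.BirchSwinnertonDyer.Theorems.ByReductionTypeAtTwoMultTowerNS2TwoAdicUnits
import Literature.NumberTheory.EllipticCurves.TwoDescentLocalImageMod8
import HarnessLib

/-!
# BirchSwinnertonDyer — rank ≥ 2 observatory: KERNEL-2DESC-CL — THE 2-ADIC SQUARE-CLASS MAP (M1-two)

HONEST FRAMING: per-curve certified theorems and census instruments; no claim on BSD in rank ≥ 2.

Construction of a term `sqClassMapTwo : SqClassMapTwo` of the interface of `…SplitImageClassTwo`: for `z ∈ ℚ_2^×`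
with `v = v_2(z)` and unit part `u = z·2^{−v} ∈ ℤ_2^×`, `cls z = (v mod 2, [ū ∈ {3,7}], [ū ∈ {3,5}])` where
`ū ∈ ℤ/8` is the image of `u` under `PadicInt.toZModPow 3`.  Multiplicativity: valuations add and `ū` is
multiplicative with odd values, on which `χ₋₁ = [· ∈ {3,7}]` and `χ₂ = [· ∈ {3,5}]` are characters (finite check).
Graded local constancy on `a + 2^M ℤ_2` (`a ∈ ℤ ∖ 0`, `v = v_2(a) < M`): the valuation is `v` (ultrametric
inequality) and the unit part is `a/2^v + 2^{M−v} t`, so `ū` is known modulo `2^{M−v}`.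
No exactness statement is made or needed (the rank bound only uses that `cls` kills squares).

Small `ℚ_2` / `ℤ/8` facts are reused from the tree (`MultTowerNS2.norm_two_zpow_padic`, `Mod8Prime.two_pow_eq_zero`,
`SplitImage.coe_two`), not restated.

Sorry-free; axioms `propext`, `Classical.choice`, `Quot.sound`.
[cite: Cassels1991LecturesEllipticCurves, §15]
-/

set_option linter.dupNamespace false
set_option autoImplicit false

namespace Summit.BirchSwinnertonDyer.BirchSwinnertonDyer.Rank2Observatory.TwoDescCl.SqClassTwo

open Summit.BirchSwinnertonDyer.BirchSwinnertonDyer.Rank2Observatory.TwoDescCl.SplitImage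

/-! ## §1 Finite checks in `ℤ/8` -/

/-- `χ₋₁` on odd residues modulo 8: `[r ∈ {3, 7}]`, i.e. `r ≡ 3 (mod 4)`. [folklore] -/
def chi4Bit (r : ZMod 8) : Bool := decide (r = 3 ∨ r = 7)

/-- `χ₂` on odd residues modulo 8: `[r ∈ {3, 5}]`. [folklore] -/
def chi8Bit (r : ZMod 8) : Bool := decide (r = 3 ∨ r = 5)

/-- Oddness of a residue modulo 8. [folklore] -/
def oddBit (r : ZMod 8) : Bool := decide (r = 1 ∨ r = 3 ∨ r = 5 ∨ r = 7)

/-- `χ₋₁` is a character on odd residues. [folklore] -/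
theorem chi4Bit_mul : ∀ r s : ZMod 8, oddBit r = true → oddBit s = true →
    chi4Bit (r * s) = (chi4Bit r != chi4Bit s) := by
  decide

/-- `χ₂` is a character on odd residues. [folklore] -/
theorem chi8Bit_mul : ∀ r s : ZMod 8, oddBit r = true → oddBit s = true →
    chi8Bit (r * s) = (chi8Bit r != chi8Bit s) := by
  decide

/-- `χ₋₁` only depends on the residue modulo 4. [folklore] -/
theorem chi4Bit_add_four_mul : ∀ r s : ZMod 8, chi4Bit (r + 4 * s) = chi4Bit r := by
  decide

/-- A residue coprime to 8 is odd. [folklore] -/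
theorem oddBit_of_coprime : ∀ r : ZMod 8, Nat.Coprime r.val 8 → oddBit r = true := by
  decide

/-- A power `2^d`, `d ≥ 2`, is a multiple of 4 in `ℤ/8`. [folklore] -/
theorem two_pow_eq_four_mul_zmod8 {d : ℕ} (hd : 2 ≤ d) : (2 : ZMod 8) ^ d = 4 * 2 ^ (d - 2) := by
  obtain ⟨k, rfl⟩ := Nat.exists_eq_add_of_le hd
  rw [pow_add, Nat.add_sub_cancel_left]
  norm_num

/-- The two bits of an integer residue are M3a's `chiBits`. [folklore] -/
theorem chiBits_intCast (k : ℤ) : (chi4Bit (k : ZMod 8), chi8Bit (k : ZMod 8)) = chiBits k := by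
  have h8 := (ZMod.intCast_mod k 8).symm
  simp only [Nat.cast_ofNat] at h8
  have h4 : k % 4 = k % 8 % 4 := by omega
  have h0 : 0 ≤ k % 8 := Int.emod_nonneg _ (by norm_num)
  have h1 : k % 8 < 8 := Int.emod_lt_of_pos _ (by norm_num)
  unfold chiBits
  rw [h8, h4]
  generalize k % 8 = m at h0 h1 ⊢
  interval_cases m <;> decide

/-- Parity of a sum of valuations. [folklore] -/
theorem decide_add_emod_two (a b : ℤ) :
    decide ((a + b) % 2 = 1) = (decide (a % 2 = 1) != decide (b % 2 = 1)) := by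
  rcases Int.emod_two_eq_zero_or_one a with ha | ha <;> rcases Int.emod_two_eq_zero_or_one b with hb | hb <;>
    simp [Int.add_emod, ha, hb]

/-! ## §2 The unit part of a 2-adic number and its residue modulo 8 -/

/-- The unit part `z · 2^{−v_2(z)}` of a 2-adic number (`0 ↦ 0`). [folklore] -/
noncomputable def unitQ (z : ℚ_[2]) : ℚ_[2] := z * (2 : ℚ_[2]) ^ (-z.valuation)

/-- The unit part of a non-zero 2-adic number has norm 1. [folklore] -/
theorem norm_unitQ {z : ℚ_[2]} (hz : z ≠ 0) : ‖unitQ z‖ = 1 := by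
  rw [unitQ, norm_mul, Summit.BirchSwinnertonDyer.BirchSwinnertonDyer.Theorems.MultTowerNS2.norm_two_zpow_padic,
    Padic.norm_eq_zpow_neg_valuation hz, neg_neg]
  have h2c : ((2 : ℕ) : ℝ) = (2 : ℝ) := Nat.cast_ofNat
  rw [h2c, ← zpow_add₀ (two_ne_zero : (2 : ℝ) ≠ 0), neg_add_cancel, zpow_zero]

/-- The unit part has norm at most 1. [folklore] -/
theorem norm_unitQ_le (z : ℚ_[2]) : ‖unitQ z‖ ≤ 1 := by
  by_cases hz : z = 0
  · rw [unitQ, hz, zero_mul, norm_zero]; exact zero_le_one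
  · exact (norm_unitQ hz).le

/-- The unit part is multiplicative. [folklore] -/
theorem unitQ_mul {z w : ℚ_[2]} (hz : z ≠ 0) (hw : w ≠ 0) : unitQ (z * w) = unitQ z * unitQ w := by
  rw [unitQ, unitQ, unitQ, Padic.valuation_mul hz hw, neg_add, zpow_add₀ (two_ne_zero : (2 : ℚ_[2]) ≠ 0)]
  ring

/-- The unit part as an element of `ℤ_2`. [folklore] -/
noncomputable def unitZ (z : ℚ_[2]) : ℤ_[2] := ⟨unitQ z, norm_unitQ_le z⟩

/-- `unitZ` is multiplicative on `ℚ_2^×`. [folklore] -/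
theorem unitZ_mul {z w : ℚ_[2]} (hz : z ≠ 0) (hw : w ≠ 0) : unitZ (z * w) = unitZ z * unitZ w :=
  Subtype.ext (by rw [PadicInt.coe_mul]; exact unitQ_mul hz hw)

/-- The unit part of a non-zero number is a unit of `ℤ_2`. [folklore] -/
theorem isUnit_unitZ {z : ℚ_[2]} (hz : z ≠ 0) : IsUnit (unitZ z) :=
  PadicInt.isUnit_iff.mpr (norm_unitQ hz)

/-- Reduction modulo 8: `ℤ_2 → ℤ/8`. [folklore] -/
noncomputable def toZ8 : ℤ_[2] →+* ZMod 8 := PadicInt.toZModPow 3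

/-- The residue modulo 8 of the unit part. [folklore] -/
noncomputable def res8 (z : ℚ_[2]) : ZMod 8 := toZ8 (unitZ z)

/-- `res8` is multiplicative on `ℚ_2^×`. [folklore] -/
theorem res8_mul {z w : ℚ_[2]} (hz : z ≠ 0) (hw : w ≠ 0) : res8 (z * w) = res8 z * res8 w := by
  rw [res8, unitZ_mul hz hw, map_mul]; rfl

/-- `res8` of a non-zero number is odd. [folklore] -/
theorem oddBit_res8 {z : ℚ_[2]} (hz : z ≠ 0) : oddBit (res8 z) = true := by
  obtain ⟨u, hu⟩ := (isUnit_unitZ hz).map toZ8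
  have hc := ZMod.val_coe_unit_coprime u
  rw [hu] at hc
  exact oddBit_of_coprime _ hc

/-! ## §3 The class map and its multiplicativity -/

/-- The 2-adic square class of `z` as three bits `(v mod 2, χ₋₁(u), χ₂(u))`. [cite: Cassels1991LecturesEllipticCurves, §15] -/
noncomputable def clsTwo (z : ℚ_[2]) : Bool × (Bool × Bool) :=
  (decide (z.valuation % 2 = 1), (chi4Bit (res8 z), chi8Bit (res8 z)))

/-- Multiplicativity of `clsTwo` on `ℚ_2^×` (componentwise XOR). [cite: Cassels1991LecturesEllipticCurves, §15] -/
theorem clsTwo_mul (z w : ℚ_[2]) (hz : z ≠ 0) (hw : w ≠ 0) :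
    clsTwo (z * w) = ((clsTwo z).1 != (clsTwo w).1,
      ((clsTwo z).2.1 != (clsTwo w).2.1, (clsTwo z).2.2 != (clsTwo w).2.2)) := by
  simp only [clsTwo]
  rw [Padic.valuation_mul hz hw, res8_mul hz hw, chi4Bit_mul _ _ (oddBit_res8 hz) (oddBit_res8 hw),
    chi8Bit_mul _ _ (oddBit_res8 hz) (oddBit_res8 hw), decide_add_emod_two]

/-! ## §4 Local constancy on a coset `a + 2^M ℤ_2` -/

/-- On `a + 2^M ℤ_2` with `v_2(a) < M` the valuation is `v_2(a)` (and the element is non-zero). [folklore] -/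
theorem valuation_of_approx {z : ℚ_[2]} {a : ℤ} {M : ℕ} {t : ℤ_[2]} (ha : a ≠ 0) (hM : padicValInt 2 a < M)
    (hz : z = (a : ℚ_[2]) + (2 : ℚ_[2]) ^ M * (t : ℚ_[2])) : z ≠ 0 ∧ z.valuation = padicValInt 2 a := by
  have ha' : (a : ℚ_[2]) ≠ 0 := Int.cast_ne_zero.mpr ha
  have h2c : ((2 : ℕ) : ℝ) = (2 : ℝ) := Nat.cast_ofNat
  have hna : ‖(a : ℚ_[2])‖ = (2 : ℝ) ^ (-(padicValInt 2 a : ℤ)) := by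
    rw [Padic.norm_eq_zpow_neg_valuation ha', Padic.valuation_intCast, h2c]
  have hnt : ‖(2 : ℚ_[2]) ^ M * (t : ℚ_[2])‖ < ‖(a : ℚ_[2])‖ := by
    have h2n : ‖(2 : ℚ_[2])‖ = (2 : ℝ)⁻¹ := by
      simpa using Summit.BirchSwinnertonDyer.BirchSwinnertonDyer.Theorems.MultTowerNS2.norm_two_zpow_padic 1
    rw [norm_mul, norm_pow, h2n, hna]
    calc (2 : ℝ)⁻¹ ^ M * ‖(t : ℚ_[2])‖ ≤ (2 : ℝ)⁻¹ ^ M * 1 := by gcongr; exact t.2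
      _ = (2 : ℝ) ^ (-(M : ℤ)) := by rw [mul_one, zpow_neg, zpow_natCast, inv_pow]
      _ < (2 : ℝ) ^ (-(padicValInt 2 a : ℤ)) := by
          apply zpow_lt_zpow_right₀ (by norm_num : (1 : ℝ) < 2); omega
  have hzn : ‖z‖ = ‖(a : ℚ_[2])‖ := by
    rw [hz, Padic.add_eq_max_of_ne (ne_of_gt hnt), max_eq_left hnt.le]
  have hz0 : z ≠ 0 := by
    intro h; rw [h, norm_zero] at hzn; exact ha' (norm_eq_zero.mp hzn.symm)
  refine ⟨hz0, ?_⟩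
  have key := Padic.norm_eq_zpow_neg_valuation hz0
  rw [hzn, hna, h2c] at key
  have hinj := zpow_right_injective₀ (by norm_num : (0 : ℝ) < 2) (by norm_num : (2 : ℝ) ≠ 1) key
  simp only [neg_inj] at hinj
  exact hinj.symm

/-- On `a + 2^M ℤ_2` with `v = v_2(a) < M` the unit part is `a/2^v + 2^{M−v} t`. [folklore] -/
theorem unitZ_of_approx {z : ℚ_[2]} {a : ℤ} {M : ℕ} {t : ℤ_[2]} (ha : a ≠ 0) (hM : padicValInt 2 a < M)
    (hz : z = (a : ℚ_[2]) + (2 : ℚ_[2]) ^ M * (t : ℚ_[2])) :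
    unitZ z = ((a / (2 : ℤ) ^ padicValInt 2 a : ℤ) : ℤ_[2]) + (2 : ℤ_[2]) ^ (M - padicValInt 2 a) * t := by
  obtain ⟨hz0, hval⟩ := valuation_of_approx ha hM hz
  set v : ℕ := padicValInt 2 a with hv
  set u : ℤ := a / (2 : ℤ) ^ v with hu
  obtain ⟨d, hd⟩ := Nat.exists_eq_add_of_le hM.le
  have hdv : M - v = d := by omega
  have hdvd : (2 : ℤ) ^ v ∣ a := by
    have h := padicValInt_dvd (p := 2) a
    rwa [Nat.cast_ofNat] at h
  have hau : a = u * (2 : ℤ) ^ v := by rw [hu, Int.ediv_mul_cancel hdvd]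
  have hauq : (a : ℚ_[2]) = (u : ℚ_[2]) * (2 : ℚ_[2]) ^ v := by
    have h := congrArg (Int.cast : ℤ → ℚ_[2]) hau
    push_cast at h; exact h
  have hvv : (2 : ℚ_[2]) ^ v * (2 : ℚ_[2]) ^ (-(v : ℤ)) = 1 := by
    rw [zpow_neg, zpow_natCast, mul_inv_cancel₀ (pow_ne_zero _ (two_ne_zero : (2 : ℚ_[2]) ≠ 0))]
  have key : unitQ z = (u : ℚ_[2]) * ((2 : ℚ_[2]) ^ v * (2 : ℚ_[2]) ^ (-(v : ℤ))) +
      (2 : ℚ_[2]) ^ d * (t : ℚ_[2]) * ((2 : ℚ_[2]) ^ v * (2 : ℚ_[2]) ^ (-(v : ℤ))) := by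
    rw [unitQ, hval, hz, hauq, hd]; ring
  rw [hvv, mul_one, mul_one] at key
  apply Subtype.ext
  rw [hdv]
  show unitQ z = (((u : ℤ_[2]) + (2 : ℤ_[2]) ^ d * t : ℤ_[2]) : ℚ_[2])
  rw [key]; push_cast [SplitImage.coe_two]; ring

/-- On `a + 2^M ℤ_2` with `v = v_2(a) < M`: `res8 z = ū + 2^{M−v} · t̄` in `ℤ/8`. [folklore] -/
theorem res8_of_approx {z : ℚ_[2]} {a : ℤ} {M : ℕ} {t : ℤ_[2]} (ha : a ≠ 0) (hM : padicValInt 2 a < M)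
    (hz : z = (a : ℚ_[2]) + (2 : ℚ_[2]) ^ M * (t : ℚ_[2])) :
    res8 z = ((a / (2 : ℤ) ^ padicValInt 2 a : ℤ) : ZMod 8) + (2 : ZMod 8) ^ (M - padicValInt 2 a) * toZ8 t := by
  rw [res8, unitZ_of_approx ha hM hz, map_add, map_mul, map_pow, map_intCast, map_ofNat]

/-- The parity bit on `a + 2^M ℤ_2`, `v_2(a) < M`. [cite: Cassels1991LecturesEllipticCurves, §15] -/
theorem clsTwo_val (z : ℚ_[2]) (a : ℤ) (M : ℕ) (t : ℤ_[2]) (ha : a ≠ 0) (hM : padicValInt 2 a < M)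
    (hz : z = (a : ℚ_[2]) + (2 : ℚ_[2]) ^ M * (t : ℚ_[2])) :
    (clsTwo z).1 = decide (padicValInt 2 a % 2 = 1) := by
  obtain ⟨-, hval⟩ := valuation_of_approx ha hM hz
  simp only [clsTwo, hval]
  have h : ((padicValInt 2 a : ℕ) : ℤ) % 2 = 1 ↔ padicValInt 2 a % 2 = 1 := by omega
  by_cases hp : padicValInt 2 a % 2 = 1
  · rw [decide_eq_true (h.mpr hp), decide_eq_true hp]
  · rw [decide_eq_false (fun h' => hp (h.mp h')), decide_eq_false hp]

/-- The `χ₋₁` bit on `a + 2^M ℤ_2`, `v_2(a) + 2 ≤ M`. [cite: Cassels1991LecturesEllipticCurves, §15] -/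
theorem clsTwo_chi4 (z : ℚ_[2]) (a : ℤ) (M : ℕ) (t : ℤ_[2]) (ha : a ≠ 0) (hM : padicValInt 2 a + 2 ≤ M)
    (hz : z = (a : ℚ_[2]) + (2 : ℚ_[2]) ^ M * (t : ℚ_[2])) :
    (clsTwo z).2.1 = decide (a / (2 : ℤ) ^ padicValInt 2 a % 4 = 3) := by
  have hr := res8_of_approx ha (by omega) hz
  rw [two_pow_eq_four_mul_zmod8 (d := M - padicValInt 2 a) (by omega), mul_assoc] at hr
  have hbits := chiBits_intCast (a / (2 : ℤ) ^ padicValInt 2 a)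
  simp only [chiBits, Prod.mk.injEq] at hbits
  simp only [clsTwo, hr, chi4Bit_add_four_mul, hbits.1]

/-- The `χ₂` bit on `a + 2^M ℤ_2`, `v_2(a) + 3 ≤ M`. [cite: Cassels1991LecturesEllipticCurves, §15] -/
theorem clsTwo_chi8 (z : ℚ_[2]) (a : ℤ) (M : ℕ) (t : ℤ_[2]) (ha : a ≠ 0) (hM : padicValInt 2 a + 3 ≤ M)
    (hz : z = (a : ℚ_[2]) + (2 : ℚ_[2]) ^ M * (t : ℚ_[2])) :
    (clsTwo z).2.2 =
      decide (a / (2 : ℤ) ^ padicValInt 2 a % 8 = 3 ∨ a / (2 : ℤ) ^ padicValInt 2 a % 8 = 5) := by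
  have hr := res8_of_approx ha (by omega) hz
  rw [Literature.NumberTheory.EllipticCurves.Mod8Prime.two_pow_eq_zero (k := M - padicValInt 2 a) (by omega),
    zero_mul, add_zero] at hr
  have hbits := chiBits_intCast (a / (2 : ℤ) ^ padicValInt 2 a)
  simp only [chiBits, Prod.mk.injEq] at hbits
  simp only [clsTwo, hr, hbits.2]

/-! ## §5 The term of the interface -/

/-- **THE 2-ADIC SQUARE-CLASS MAP** (M1-two): a term of the interface `SqClassMapTwo` of `…SplitImageClassTwo`.
With it, `vecTwo_mem_splitImgTwo sqClassMapTwo …` is an unconditional statement about `ℚ_2`-points.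
[cite: Cassels1991LecturesEllipticCurves, §15] -/
noncomputable def sqClassMapTwo : SqClassMapTwo where
  cls := clsTwo
  cls_mul := clsTwo_mul
  cls_val := clsTwo_val
  cls_chi4 := clsTwo_chi4
  cls_chi8 := clsTwo_chi8

/-- The class map of `sqClassMapTwo` is `clsTwo`. [folklore] -/
theorem sqClassMapTwo_cls (z : ℚ_[2]) : sqClassMapTwo.cls z = clsTwo z := rfl

end Summit.BirchSwinnertonDyer.BirchSwinnertonDyer.Rank2Observatory.TwoDescCl.SqClassTwo
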